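import Summits.BirchSwinnertonDyer.BirchSwinnertonDyer.Theorems.SchneiderFreeAdditiveX3AnticycControlAdditiveKStubPtSurj
import Summits.BirchSwinnertonDyer.BirchSwinnertonDyer.Theorems.SchneiderFreeAdditiveX3PoitouTateShaDualOfReadoutUnramified
import Summits.BirchSwinnertonDyer.BirchSwinnertonDyer.Theorems.SchneiderFreeAdditiveX3PoitouTateReciprocityEqualityHolds
import HarnessLib

/-!
# Crux `AnticycControlAdditiveK` (route `SchneiderFreeAdditiveX3`, item stmt-BirchSwinnertonDyer-19295): the registered stub
# `stub_coinv` (L10, skeleton v3-K c0242a50) under the crux's own Kolyvagin antecedent ONLY — PT (ii) now a tree theorem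

Cell `bsd-schneider-ideate`, seat `bsd-schneider-door-c6` (prover, generation 19).  PARTITION: board row B6 ∩ X3 ∩ sst-twist,
`r = 1`, of `Rank1Residual.partition` — CONTROL corner (crux `AnticycControlAdditiveK`; facts binder `ControlFacts` (i) =
`poitouTate_selmerStructure_duality` ✓ door-c4 g18, (ii) = `poitouTate_sha_tateDual` ✓ for every number field since door-c4 g19's
`poitouTate_sha_tateDual_of_readoutUnramified` (p629462) and door-c5 g18's `hRur_holds` (p629556)).  bears_on: K1-door (r1, B6∩X3-sst)
(route-BirchSwinnertonDyer-SchneiderFreeAdditiveX3 items 18969 → 19295).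

door-c6 g18's `stub_coinv_of_poitouTate_sha (hPT2) (hKo)` (file `…AnticycControlAdditiveKStubPtSurj.lean`) proved the registered
`stub_coinv` signature VERBATIM modulo PT (ii) for every `K` and the crux's Kolyvagin antecedent.  PT (ii) is now discharged in the
tree (see above; `Finite (TateDual K M n)` from `DiscreteGaloisModule.TateDual.finite`), so the last registered stub of skeleton v3-K
is closed in its strongest in-tree form:

* **`stub_coinv_of_kolyvagin (hKo) : <registered stub_coinv signature VERBATIM>`** — (L10) JSW17 Lemma 3.3.3, the `Γ`-coinvariants of
  `Sel_𝔭(K_∞^{ac}, E[p^∞])` vanish at every B6 frame, from the crux's own antecedent `∀ N W K, kolyvagin N W K` and NOTHING ELSE.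
  Like its sibling `stub_ptSurj` (door-c6 g18 `stub_ptSurj_of_kolyvagin`), the registered `stub_coinv` signature omits that antecedent
  (which `stub_baseCountTors` and the crux decl carry); the finiteness of `Sel_𝔭̄(K, E[p^∞])` the coinvariant argument consumes
  (`finite_selmerAcBase_of_rankOne_anyTorsion`: rank `E(K) = 1`, `#Ш(E/K)[p^∞] < ∞`) comes from the non-torsion Heegner point ONLY
  through the cite-only Kolyvagin theorem, so VERBATIM the stub is exactly `kolyvagin → stub_coinv`, proved here.

HONEST FRAMING: conditional on the cite-only Kolyvagin theorem exactly as the crux is (hypothesis BY NAME, no `Prop` fact minted);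
a `--supports` helper, closes nothing by itself; BSD is not proved by any of this.

References: [JetchevSkinnerWan2017] Lemma 3.3.3, Prop. 3.2.1 (arXiv:1512.06894 pp. 10–12); [MilneADT2006] I Thm. 4.10 (a),(b),
Lemma 4.13; [Gross1991] Thm. 1.3 (Kolyvagin); [GreenbergLNM1716] §3–§4.
-/

noncomputable section

open scoped Classical

open Field NumberField IsDedekindDomain WeierstrassCurve
open Literature.NumberTheory.EllipticCurves Literature.NumberTheory.EllipticCurves.GreenbergSelmer
open Literature.NumberTheory.GaloisRepresentations
open Literature.NumberTheory.GaloisCohomology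
open Literature.NumberTheory.EllipticCurves.ModularForms
  Literature.NumberTheory.EllipticCurves.Rank1Residual
  Literature.NumberTheory.EllipticCurves.Rank1Residual.Typed
  Summit.BirchSwinnertonDyer.Rank1Residual
  Summit.BirchSwinnertonDyer.Rank1Residual.X11b
  Summit.BirchSwinnertonDyer.Rank1Residual.X11b.AcSelmer
  Summit.BirchSwinnertonDyer.Rank1Residual.X11b.LocBridge

set_option linter.dupNamespace false

namespace Summit.BirchSwinnertonDyer.BirchSwinnertonDyer.Theorems.SchneiderFreeAdditiveX3

open Summit.BirchSwinnertonDyer.BirchSwinnertonDyer.Theses.SchneiderFreeAdditiveX3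
  Summit.BirchSwinnertonDyer.BirchSwinnertonDyer.Theorems.SchneiderFree
  Summit.BirchSwinnertonDyer.BirchSwinnertonDyer.Theorems.SchneiderFreeControlAtoms

/-- **The registered stub `stub_coinv` of crux `AnticycControlAdditiveK` (skeleton v3-K c0242a50, item stmt-BirchSwinnertonDyer-19295)
UNDER THE CRUX'S OWN KOLYVAGIN ANTECEDENT — nothing else**: at every B6 frame, (L10) the `Γ`-coinvariants of the anticyclotomic
Selmer group `Sel_𝔭(K_∞^{ac}, E[p^∞])` vanish (`X11b.CoinvariantsTrivialAt`, JSW17 Lemma 3.3.3).  door-c6 g18's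
`stub_coinv_of_poitouTate_sha` with PT (ii) `poitouTate_sha_tateDual K` DISCHARGED for every number field by the tree theorems
`PoitouTateReduction.poitouTate_sha_tateDual_of_readoutUnramified` (door-c4 g19) and `PoitouTateReduction.hRur_holds` (door-c5 g18).
The remaining hypothesis is the cite-only `kolyvagin`, carried by the crux decl but omitted by the registered `stub_coinv` signature:
VERBATIM the stub is therefore exactly `(∀ N W K, kolyvagin N W K) → stub_coinv`, proved here.  HONEST FRAMING: conditional on the
cite-only Kolyvagin theorem exactly as the crux is; BSD is not proved by this.
[cite: JetchevSkinnerWan2017, Lemma 3.3.3 and Prop. 3.2.1 (arXiv:1512.06894 pp. 10–12)] [cite: MilneADT2006, Ch. I, Thm. 4.10 (a),(b)]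
[cite: Gross1991, Thm. 1.3] -/
theorem stub_coinv_of_kolyvagin
    (hKo : ∀ (N : ℕ) [NeZero N] (W : WeierstrassCurve ℚ) (K : Type) [Field K] [NumberField K],
      Literature.NumberTheory.EllipticCurves.kolyvagin N W K) :
    ∀ (W : WeierstrassCurve ℚ) [W.IsElliptic] [W.IsGloballyMinimal] (p : ℕ) [Fact p.Prime],
      W.analyticRank = 1 → p ≠ 2 → ClassX3 W p → Additive.SubSemistableTwist W p →
      ∀ (N : ℕ) [NeZero N] (K : Type) [Field K] [NumberField K]
        (Dt : ModularParametrizationData W N) (H : HeegnerDatum N (NumberField.discr K)) (ι : K →+* ℂ)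
        (P : (W.baseChange K).toAffine.Point),
        W.analyticRank = 1 → Additive.N10.Locus W p → W.conductorNorm ℤ = N →
        ∀ hK : IsImaginaryQuadratic K,
        Odd (NumberField.discr K) → ¬ p ∣ Units.torsionOrder K → SatisfiesHeegnerHypothesis N K →
        (W.quadraticTwist (NumberField.discr K : ℚ)).entireLFunction 1 ≠ 0 →
        WeierstrassCurve.Affine.Point.map ι.toRatAlgHom P = heegnerPointComplex Dt H →
        ¬ IsOfFinAddOrder P →
        ∀ (κ : ZpExtension K p), κ.IsAnticyclotomic →
          ∀ (γ : Field.absoluteGaloisGroup K) [Fact (κ.IsTopGenerator γ)]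
            (𝔭 : HeightOneSpectrum (𝓞 K)) (h𝔭 : ((p : ℕ) : 𝓞 K) ∈ 𝔭.asIdeal)
            (he : 𝔭.asIdeal.ramificationIdx (𝓞 ℚ) = 1) (hf : 𝔭.asIdeal.inertiaDeg (𝓞 ℚ) = 1),
            X11b.CoinvariantsTrivialAt (W.baseChange K) p κ 𝔭 γ :=
  -- PT (ii) for every number field: door-c4 g19's reduction to `hRur`, discharged by door-c5 g18's `hRur_holds`
  stub_coinv_of_poitouTate_sha
    (fun K _ _ =>
      PoitouTateReduction.poitouTate_sha_tateDual_of_readoutUnramified (K := K)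
        fun n _ M _ _ _ _ ρ₀ hM f => by
          haveI := DiscreteGaloisModule.TateDual.finite K M n
          exact PoitouTateReduction.hRur_holds ρ₀ hM f)
    hKo

end Summit.BirchSwinnertonDyer.BirchSwinnertonDyer.Theorems.SchneiderFreeAdditiveX3

end
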